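import Literature.MathematicalPhysics.QuantumLattice.LTQOFrustrationFreeProofs
import Literature.MathematicalPhysics.QuantumLattice.LTQOProofs
import Literature.MathematicalPhysics.QuantumLattice.SpinSystemProofs
import HarnessLib

/-!
# LTQO estimates for the Michalakis–Zwolak decomposition (constants, Lemma 3, Corollary 2)

Top-down layer (seat B) of the formalisation of the Michalakis–Zwolak stability theorem
(hubbard.S19, `Literature.MathematicalPhysics.QuantumLattice.michalakis_zwolak`), companion of
`StabilityFinalArgumentProofs` / `StabilityReductionProofs`. It provides the elementary
consequences of Local-TQO (`HasLTQO`, MZ13 Definition 4) that enter Lemma 3 (smallness of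
`Δ_u = P₀ X̃_u P₀`) and Lemma 4 (the bound `‖Σ_{r ≤ ℓ} X̃_u(r) P_{b_u(2ℓ)}‖ ≈ ‖… P₀‖`,
MZ13 Corollary 2) of Michalakis–Zwolak, CMP **322** (2013) 277 = arXiv:1109.1588:

* algebra of the LTQO constant `c_P(O) = tr(P O)/tr P` (`ltqoConst`): additivity, homogeneity,
  reality for Hermitian `O`, and the bound `|c_P(O)| ≤ ‖O‖` for an orthogonal projection `P` and
  Hermitian `O` (from the Loewner bounds `−‖O‖ ≤ O ≤ ‖O‖` and `tr (P Y P) ≥ 0` for `Y ≥ 0`);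
* **constants of nested projections agree up to the LTQO error**: if `P' P = P'` (`P'` projects
  onto a subspace of the range of `P`, e.g. `P' = P₀`, `P = P_{b_u(r+ℓ)}`) and
  `‖P O P − c_P(O) P‖ ≤ η`, then `|c_{P'}(O) − c_P(O)| ≤ η` and hence
  `‖P' O P' − c_{P'}(O) P'‖ ≤ 2η` (`norm_conj_sub_smul_self_le_of_mul_eq`) — this is the step
  "From Local-TQO we know that … `‖P₀ X̃_u(r) P₀‖ ≤ ‖X_u(r)‖ Δ₀(L − r)`" of MZ13 Lemma 3 (p. 12),
  where `X̃ = X − c(X)` uses the *global* constant `c = c_{P₀}` while Definition 4 controls the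
  *local* one;
* **MZ13 Corollary 2** (arXiv:1109.1588 p. 8, eq. (8): "`|‖O_A P_{A(ℓ)}‖ − ‖O_A P₀‖| ≤
  2‖O_A‖ √Δ₀(ℓ)`"): for two projections `P₁`, `P₂` below `P` (`Pᵢ P = Pᵢ`, both non-zero) and
  `‖P OᴴO P − c_P(OᴴO) P‖ ≤ η`, `|‖O P₁‖² − ‖O P₂‖²| ≤ 2η` and `|‖O P₁‖ − ‖O P₂‖| ≤ √(2η)`
  (`abs_norm_mul_sub_norm_mul_le`), via the C⋆-identity `‖O Pᵢ‖² = ‖Pᵢ OᴴO Pᵢ‖`;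
* the torus specialisations under `HasLTQO Φ Δ` for observables supported in `cellBall x r`,
  `2(r + ℓ) < L`, and regions containing `cellBall x (r + ℓ)` (in particular the whole torus,
  `P_univ = P₀`).

No definitions and no named facts are introduced (theorems only).
-/

noncomputable section

open Matrix Finset Module
open scoped InnerProductSpace ComplexOrder Matrix.Norms.L2Operator

namespace Literature.MathematicalPhysics.QuantumLattice

open Literature.Probability.LatticeModels

/-! ### Algebra of the LTQO constant -/

section Const

variable {n : Type*} [Fintype n]

omit [Fintype n] in
/-- `ltqoConst` unfolded. [folklore] -/
theorem ltqoConst_def [Fintype n] (P O : Matrix n n ℂ) :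
    ltqoConst P O = (P * O).trace / P.trace := rfl

/-- The LTQO constant is additive in the observable. [folklore] -/
theorem ltqoConst_add (P O₁ O₂ : Matrix n n ℂ) :
    ltqoConst P (O₁ + O₂) = ltqoConst P O₁ + ltqoConst P O₂ := by
  simp [ltqoConst, Matrix.mul_add, trace_add, add_div]

/-- The LTQO constant is subtractive in the observable. [folklore] -/
theorem ltqoConst_sub (P O₁ O₂ : Matrix n n ℂ) :
    ltqoConst P (O₁ - O₂) = ltqoConst P O₁ - ltqoConst P O₂ := by
  simp [ltqoConst, Matrix.mul_sub, trace_sub, sub_div]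

/-- The LTQO constant is homogeneous in the observable. [folklore] -/
theorem ltqoConst_smul (P : Matrix n n ℂ) (c : ℂ) (O : Matrix n n ℂ) :
    ltqoConst P (c • O) = c * ltqoConst P O := by
  simp [ltqoConst, Matrix.mul_smul, trace_smul, mul_div_assoc]

/-- The LTQO constant of `0` is `0`. [folklore] -/
@[simp] theorem ltqoConst_zero (P : Matrix n n ℂ) : ltqoConst P 0 = 0 := by
  simp [ltqoConst]

/-- The LTQO constant of a finite sum. [folklore] -/
theorem ltqoConst_sum {ι : Type*} (P : Matrix n n ℂ) (s : Finset ι) (O : ι → Matrix n n ℂ) :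
    ltqoConst P (∑ i ∈ s, O i) = ∑ i ∈ s, ltqoConst P (O i) := by
  classical
  induction s using Finset.induction_on with
  | empty => simp
  | insert i s hi ih => rw [sum_insert hi, sum_insert hi, ltqoConst_add, ih]

/-- The trace of `P O` is real for Hermitian `P`, `O`: `star tr(P O) = tr((P O)ᴴ) = tr(O P) =
tr(P O)`. [folklore] -/
theorem star_trace_mul_of_isHermitian {P O : Matrix n n ℂ} (hP : P.IsHermitian)
    (hO : O.IsHermitian) : star (P * O).trace = (P * O).trace := by
  rw [← trace_conjTranspose, conjTranspose_mul, hP.eq, hO.eq, trace_mul_comm]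

/-- The LTQO constant of a Hermitian observable with respect to a Hermitian `P` is real.
[folklore] -/
theorem star_ltqoConst {P O : Matrix n n ℂ} (hP : P.IsHermitian) (hO : O.IsHermitian) :
    star (ltqoConst P O) = ltqoConst P O := by
  rw [ltqoConst, star_div₀, star_trace_mul_of_isHermitian hP hO, ← trace_conjTranspose, hP.eq]

/-- The LTQO constant of a Hermitian observable is a real number (as a complex number it equals
the cast of its real part). [folklore] -/
theorem ltqoConst_eq_re {P O : Matrix n n ℂ} (hP : P.IsHermitian) (hO : O.IsHermitian) :
    ltqoConst P O = ((ltqoConst P O).re : ℂ) :=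
  (Complex.conj_eq_iff_re.mp (star_ltqoConst hP hO)).symm

end Const

/-! ### Loewner bounds and the size of the constant -/

section Bounds

variable {n : Type*} [Fintype n] [DecidableEq n]

/-- The quadratic form `star v ⬝ᵥ (M v)` is the `EuclideanSpace` inner product
`⟪v, T_M v⟫`. [folklore] -/
theorem star_dotProduct_mulVec_eq_inner_toLp (M : Matrix n n ℂ) (v : n → ℂ) :
    star v ⬝ᵥ (M *ᵥ v) =
      ⟪(WithLp.toLp 2 v : EuclideanSpace ℂ n), toEuclideanLin M (WithLp.toLp 2 v)⟫_ℂ := by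
  rw [EuclideanSpace.inner_eq_star_dotProduct, ofLp_toLpLin, toLin'_apply, WithLp.ofLp_toLp,
    dotProduct_comm]

/-- **Loewner upper bound**: `‖O‖·1 − O ≥ 0` for Hermitian `O` (every expectation of `O` is at
most `‖O‖`). [folklore] -/
private theorem loewner_norm_smul_one_sub_posSemidef {O : Matrix n n ℂ} (hO : O.IsHermitian) :
    ((‖O‖ : ℂ) • (1 : Matrix n n ℂ) - O).PosSemidef := by
  have hH : ((‖O‖ : ℂ) • (1 : Matrix n n ℂ) - O).IsHermitian := by
    refine IsHermitian.sub ?_ hO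
    rw [IsHermitian, conjTranspose_smul, conjTranspose_one]
    simp
  refine PosSemidef.of_dotProduct_mulVec_nonneg hH fun v => ?_
  set x : EuclideanSpace ℂ n := WithLp.toLp 2 v with hx
  have hform : star v ⬝ᵥ (((‖O‖ : ℂ) • (1 : Matrix n n ℂ) - O) *ᵥ v) =
      (‖O‖ : ℂ) * ⟪x, x⟫_ℂ - ⟪x, toEuclideanLin O x⟫_ℂ := by
    rw [star_dotProduct_mulVec_eq_inner_toLp, map_sub, LinearMap.sub_apply, inner_sub_right,
      LinearEquiv.map_smul, LinearMap.smul_apply, inner_smul_right, Matrix.toLpLin_one,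
      LinearMap.id_apply]
  rw [hform, Complex.nonneg_iff]
  have h1 := (abs_le.mp (abs_re_inner_toEuclideanLin_le (𝕜 := ℂ) O x)).2
  rw [← Matrix.cstar_norm_def] at h1
  have h2 : (⟪x, x⟫_ℂ).re = ‖x‖ ^ 2 := by
    rw [← RCLike.re_to_complex, ← norm_sq_eq_re_inner]
  have h3 : (⟪x, x⟫_ℂ).im = 0 := by
    rw [← RCLike.im_to_complex, inner_self_im]
  have h4 : (⟪x, toEuclideanLin O x⟫_ℂ).im = 0 := by
    have := hO.im_star_dotProduct_mulVec_self v
    rwa [star_dotProduct_mulVec_eq_inner_toLp, RCLike.im_to_complex] at this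
  constructor
  · simp only [Complex.sub_re, Complex.re_ofReal_mul, h2]
    have : RCLike.re ⟪x, toEuclideanLin O x⟫_ℂ = (⟪x, toEuclideanLin O x⟫_ℂ).re := rfl
    linarith
  · rw [Complex.sub_im, Complex.mul_im, Complex.ofReal_re, Complex.ofReal_im, h3, h4]
    ring

/-- **Loewner lower bound**: `‖O‖·1 + O ≥ 0` for Hermitian `O`. [folklore] -/
private theorem loewner_norm_smul_one_add_posSemidef {O : Matrix n n ℂ} (hO : O.IsHermitian) :
    ((‖O‖ : ℂ) • (1 : Matrix n n ℂ) + O).PosSemidef := by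
  have h := loewner_norm_smul_one_sub_posSemidef hO.neg
  rwa [norm_neg, sub_neg_eq_add] at h

omit [DecidableEq n] in
/-- For an orthogonal projection `P` and `Y ≥ 0`: `re tr(P Y) ≥ 0` (`tr(P Y) = tr(P Y Pᴴ)` and
`P Y Pᴴ ≥ 0`). [folklore] -/
theorem re_trace_projection_mul_nonneg {P Y : Matrix n n ℂ} (hP : P.IsHermitian)
    (hP2 : P * P = P) (hY : Y.PosSemidef) : 0 ≤ ((P * Y).trace).re := by
  have h1 : (P * Y * Pᴴ).PosSemidef := hY.mul_mul_conjTranspose_same P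
  have h2 : (P * Y * Pᴴ).trace = (P * Y).trace := by
    rw [hP.eq, trace_mul_cycle, hP2]
  have h3 := h1.trace_nonneg
  rw [h2, Complex.nonneg_iff] at h3
  exact h3.1

/-- **The trace bound** `|tr(P O)| ≤ ‖O‖ · tr P` for an orthogonal projection `P` and a Hermitian
`O` (both traces are real; from `tr(P (‖O‖ ± O)) ≥ 0`). [folklore] -/
theorem norm_trace_mul_le_of_projection {P O : Matrix n n ℂ} (hP : P.IsHermitian)
    (hP2 : P * P = P) (hO : O.IsHermitian) : ‖(P * O).trace‖ ≤ ‖O‖ * (P.trace).re := by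
  have hup := re_trace_projection_mul_nonneg hP hP2 (loewner_norm_smul_one_sub_posSemidef hO)
  have hlow := re_trace_projection_mul_nonneg hP hP2 (loewner_norm_smul_one_add_posSemidef hO)
  rw [Matrix.mul_sub, trace_sub, Matrix.mul_smul, Matrix.mul_one, trace_smul, smul_eq_mul,
    Complex.sub_re, Complex.re_ofReal_mul] at hup
  rw [Matrix.mul_add, trace_add, Matrix.mul_smul, Matrix.mul_one, trace_smul, smul_eq_mul,
    Complex.add_re, Complex.re_ofReal_mul] at hlow
  -- `tr(P O)` is real
  have hreal : (P * O).trace = (((P * O).trace).re : ℂ) :=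
    (Complex.conj_eq_iff_re.mp (star_trace_mul_of_isHermitian hP hO)).symm
  rw [hreal, Complex.norm_real, Real.norm_eq_abs, abs_le]
  constructor <;> linarith

omit [DecidableEq n] in
/-- The trace of an orthogonal projection is a non-negative real: `tr P = tr(Pᴴ P) ≥ 0`.
[folklore] -/
theorem trace_projection_eq_re {P : Matrix n n ℂ} (hP : P.IsHermitian) (hP2 : P * P = P) :
    P.trace = ((P.trace).re : ℂ) ∧ 0 ≤ (P.trace).re := by
  have h1 : (Pᴴ * P).PosSemidef := posSemidef_conjTranspose_mul_self P
  rw [hP.eq, hP2] at h1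
  have h2 := h1.trace_nonneg
  rw [Complex.nonneg_iff] at h2
  refine ⟨Complex.ext (by simp) (by simpa using h2.2.symm), h2.1⟩

/-- **The LTQO constant is bounded by the norm**: `|c_P(O)| ≤ ‖O‖` for an orthogonal projection
`P` and a Hermitian observable `O` (also when `P = 0`, by the junk value `c = 0`). MZ13 uses this
in Lemma 3 ("`‖P₀ X̃_u(r) P₀‖ ≤ ‖X_u(r)‖ + |c(X_u(r))| ≤ 2J f₁(r)`", arXiv:1109.1588 p. 12).
[cite: MichalakisZwolakCMP2013, §5 Lemma 3 (arXiv:1109.1588 p. 12)] -/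
theorem norm_ltqoConst_le {P O : Matrix n n ℂ} (hP : P.IsHermitian) (hP2 : P * P = P)
    (hO : O.IsHermitian) : ‖ltqoConst P O‖ ≤ ‖O‖ := by
  obtain ⟨htr, htr0⟩ := trace_projection_eq_re hP hP2
  rw [ltqoConst, norm_div]
  by_cases h0 : P.trace = 0
  · rw [h0, norm_zero, div_zero]
    exact norm_nonneg O
  · have hpos : 0 < ‖P.trace‖ := norm_pos_iff.mpr h0
    rw [div_le_iff₀ hpos]
    have h1 := norm_trace_mul_le_of_projection hP hP2 hO
    have h2 : ‖P.trace‖ = (P.trace).re := by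
      rw [htr, Complex.norm_real, Real.norm_eq_abs, abs_of_nonneg htr0]
      simp
    rw [h2]
    exact h1

/-- `‖1‖ ≤ 1` for the L²-operator norm on square matrices (`= 1` unless the index type is
empty). [folklore] -/
private theorem l2_opNorm_one_le : ‖(1 : Matrix n n ℂ)‖ ≤ 1 := by
  rw [Matrix.cstar_norm_def, map_one, ContinuousLinearMap.one_def]
  exact ContinuousLinearMap.norm_id_le

/-- `‖c • 1‖ ≤ ‖c‖` for the L²-operator norm. [folklore] -/
theorem norm_smul_one_le (c : ℂ) : ‖c • (1 : Matrix n n ℂ)‖ ≤ ‖c‖ := by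
  rw [norm_smul]
  exact mul_le_of_le_one_right (norm_nonneg c) l2_opNorm_one_le

/-- `‖X − c(X)·1‖ ≤ 2‖X‖` for the LTQO recentring of a Hermitian observable. [folklore] -/
theorem norm_sub_ltqoConst_smul_one_le {P X : Matrix n n ℂ} (hP : P.IsHermitian)
    (hP2 : P * P = P) (hX : X.IsHermitian) :
    ‖X - ltqoConst P X • (1 : Matrix n n ℂ)‖ ≤ 2 * ‖X‖ := by
  have h1 := norm_ltqoConst_le hP hP2 hX
  calc ‖X - ltqoConst P X • (1 : Matrix n n ℂ)‖
      ≤ ‖X‖ + ‖ltqoConst P X • (1 : Matrix n n ℂ)‖ := norm_sub_le _ _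
    _ ≤ ‖X‖ + ‖ltqoConst P X‖ := by gcongr; exact norm_smul_one_le _
    _ ≤ ‖X‖ + ‖X‖ := by gcongr
    _ = 2 * ‖X‖ := by ring

end Bounds

/-! ### Nested projections: comparison of constants (Lemma 3) and Corollary 2 -/

section Nested

variable {n : Type*} [Fintype n] [DecidableEq n]

omit [DecidableEq n] in
/-- A non-zero orthogonal projection has non-zero trace (`tr P = tr(Pᴴ P) = Σ |Pᵢⱼ|²`).
[folklore] -/
theorem trace_ne_zero_of_projection_ne_zero {P : Matrix n n ℂ} (hP : P.IsHermitian)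
    (hP2 : P * P = P) (h0 : P ≠ 0) : P.trace ≠ 0 := by
  intro htr
  have h1 : (Pᴴ * P).trace = 0 := by rw [hP.eq, hP2, htr]
  rw [trace_conjTranspose_mul_self_eq_zero_iff] at h1
  exact h0 h1

/-- A non-zero orthogonal projection has norm `1` (`‖P‖ = ‖Pᴴ P‖ = ‖P‖²` and `‖P‖ ≤ 1`).
[folklore] -/
theorem norm_eq_one_of_projection_ne_zero {P : Matrix n n ℂ} (hP : P.IsHermitian)
    (hP2 : P * P = P) (h0 : P ≠ 0) : ‖P‖ = 1 := by
  have h1 := l2_opNorm_conjTranspose_mul_self P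
  rw [hP.eq, hP2] at h1
  have hpos : 0 < ‖P‖ := norm_pos_iff.mpr h0
  have h2 : ‖P‖ * 1 = ‖P‖ * ‖P‖ := by rw [mul_one]; exact h1
  exact (mul_left_cancel₀ hpos.ne' h2).symm

/-- `‖c • P‖ = ‖c‖` for a non-zero orthogonal projection `P`. [folklore] -/
theorem norm_smul_projection {P : Matrix n n ℂ} (hP : P.IsHermitian) (hP2 : P * P = P)
    (h0 : P ≠ 0) (c : ℂ) : ‖c • P‖ = ‖c‖ := by
  rw [norm_smul, norm_eq_one_of_projection_ne_zero hP hP2 h0, mul_one]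

omit [DecidableEq n] in
/-- The difference of the LTQO constants of nested projections (`P' P = P'`, `P P' = P'`) is the
`P'`-constant of the LTQO defect of `P`:
`c_{P'}(O) − c_P(O) = c_{P'}(P O P − c_P(O) P)`. [folklore] -/
theorem ltqoConst_sub_ltqoConst_eq {P P' O : Matrix n n ℂ} (hP'P : P' * P = P')
    (hPP' : P * P' = P') (htr : P'.trace ≠ 0) :
    ltqoConst P' O - ltqoConst P O = ltqoConst P' (P * O * P - ltqoConst P O • P) := by
  have h1 : (P' * (P * O * P - ltqoConst P O • P)).trace =
      (P' * O).trace - ltqoConst P O * P'.trace := by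
    rw [Matrix.mul_sub, trace_sub, Matrix.mul_smul, trace_smul, hP'P, smul_eq_mul,
      ← Matrix.mul_assoc, ← Matrix.mul_assoc, hP'P, trace_mul_cycle, hPP']
  rw [ltqoConst_def P' (P * O * P - _), h1, sub_div, mul_div_assoc, div_self htr, mul_one,
    ltqoConst_def]

/-- **Constants of nested projections agree up to the LTQO error.** If `P`, `P'` are orthogonal
projections with `P' P = P'` and `P' ≠ 0`, `O` is Hermitian and `‖P O P − c_P(O) P‖ ≤ η`, then
`|c_{P'}(O) − c_P(O)| ≤ η` (`c_{P'}` of the Hermitian defect is bounded by its norm,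
`norm_ltqoConst_le`). With `P' = P₀` and `P = P_{b_u(r+ℓ)}` this identifies the global constant
`c(X_u(r)) = tr(P₀ X_u(r))/tr P₀` of MZ13 Lemma 3 with the local one of Definition 4 up to
`‖X_u(r)‖ Δ₀(ℓ)`. [cite: MichalakisZwolakCMP2013, §4 Definition 4 and §5 Lemma 3 (arXiv:1109.1588 pp. 7, 12)] -/
theorem norm_ltqoConst_sub_le {P P' O : Matrix n n ℂ} (hP : P.IsHermitian)
    (hP' : P'.IsHermitian) (hP'2 : P' * P' = P') (hP'P : P' * P = P') (h0 : P' ≠ 0)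
    (hO : O.IsHermitian) {η : ℝ} (h : ‖P * O * P - ltqoConst P O • P‖ ≤ η) :
    ‖ltqoConst P' O - ltqoConst P O‖ ≤ η := by
  have hPP' : P * P' = P' := by
    have h1 := congrArg conjTranspose hP'P
    rwa [conjTranspose_mul, hP.eq, hP'.eq] at h1
  rw [ltqoConst_sub_ltqoConst_eq hP'P hPP' (trace_ne_zero_of_projection_ne_zero hP' hP'2 h0)]
  refine (norm_ltqoConst_le hP' hP'2 ?_).trans h
  -- the defect is Hermitian
  have hc : star (ltqoConst P O) = ltqoConst P O := star_ltqoConst hP hO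
  refine IsHermitian.sub ?_ ?_
  · rw [IsHermitian, conjTranspose_mul, conjTranspose_mul, hP.eq, hO.eq, Matrix.mul_assoc]
  · rw [IsHermitian, conjTranspose_smul, hP.eq, hc]

/-- **LTQO with the intrinsic constant of the smaller projection** (the form used in MZ13
Lemma 3): under the hypotheses of `norm_ltqoConst_sub_le`,
`‖P' O P' − c_{P'}(O) P'‖ ≤ 2η` (transfer `‖P' O P' − c_P(O) P'‖ ≤ η`,
`norm_conj_sub_smul_le_of_mul_eq`, plus `|c_{P'}(O) − c_P(O)| ‖P'‖ ≤ η`). MZ13 Lemma 3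
(arXiv:1109.1588 p. 12: "`‖P₀ X̃_u(r) P₀‖ ≤ ‖X_u(r)‖ Δ₀(L − r)`", here with the honest factor `2`
accounting for the two constants). [cite: MichalakisZwolakCMP2013, §5 Lemma 3 (arXiv:1109.1588 p. 12)] -/
theorem norm_conj_sub_smul_self_le_of_mul_eq {P P' O : Matrix n n ℂ} (hP : P.IsHermitian)
    (hP' : P'.IsHermitian) (hP'2 : P' * P' = P') (hP'P : P' * P = P') (h0 : P' ≠ 0)
    (hO : O.IsHermitian) {η : ℝ} (h : ‖P * O * P - ltqoConst P O • P‖ ≤ η) :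
    ‖P' * O * P' - ltqoConst P' O • P'‖ ≤ 2 * η := by
  have h1 := norm_conj_sub_smul_le_of_mul_eq hP hP' hP'2 hP'P h
  have h2 := norm_ltqoConst_sub_le hP hP' hP'2 hP'P h0 hO h
  have hid : P' * O * P' - ltqoConst P' O • P' =
      (P' * O * P' - ltqoConst P O • P') - (ltqoConst P' O - ltqoConst P O) • P' := by
    rw [sub_smul]
    abel
  rw [hid]
  calc ‖(P' * O * P' - ltqoConst P O • P') - (ltqoConst P' O - ltqoConst P O) • P'‖
      ≤ ‖P' * O * P' - ltqoConst P O • P'‖ + ‖(ltqoConst P' O - ltqoConst P O) • P'‖ :=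
        norm_sub_le _ _
    _ = ‖P' * O * P' - ltqoConst P O • P'‖ + ‖ltqoConst P' O - ltqoConst P O‖ := by
        rw [norm_smul_projection hP' hP'2 h0]
    _ ≤ η + η := add_le_add h1 h2
    _ = 2 * η := by ring

/-- `‖O P'‖² = ‖P' OᴴO P'‖` for a Hermitian `P'` (the C⋆-identity `‖Aᴴ A‖ = ‖A‖²` for
`A = O P'`). [folklore] -/
theorem norm_mul_projection_sq {P' : Matrix n n ℂ} (hP' : P'.IsHermitian) (O : Matrix n n ℂ) :
    ‖O * P'‖ ^ 2 = ‖P' * (Oᴴ * O) * P'‖ := by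
  rw [sq, ← l2_opNorm_conjTranspose_mul_self (O * P'), conjTranspose_mul, hP'.eq]
  congr 1
  simp only [Matrix.mul_assoc]

/-- **MZ13 Corollary 2, squared form.** For orthogonal projections `P₁`, `P₂` below `P`
(`Pᵢ P = Pᵢ`, both non-zero) and `‖P OᴴO P − c_P(OᴴO) P‖ ≤ η`:
`|‖O P₁‖² − ‖O P₂‖²| ≤ 2η` (both squares are within `η` of `|c_P(OᴴO)|`).
[cite: MichalakisZwolakCMP2013, §4 Corollary 2 (arXiv:1109.1588 p. 8, App. A)] -/
theorem abs_norm_mul_sq_sub_le {P P₁ P₂ O : Matrix n n ℂ} (hP : P.IsHermitian)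
    (hP₁ : P₁.IsHermitian) (hP₁2 : P₁ * P₁ = P₁) (hP₁P : P₁ * P = P₁) (h₁0 : P₁ ≠ 0)
    (hP₂ : P₂.IsHermitian) (hP₂2 : P₂ * P₂ = P₂) (hP₂P : P₂ * P = P₂) (h₂0 : P₂ ≠ 0)
    {η : ℝ} (h : ‖P * (Oᴴ * O) * P - ltqoConst P (Oᴴ * O) • P‖ ≤ η) :
    |‖O * P₁‖ ^ 2 - ‖O * P₂‖ ^ 2| ≤ 2 * η := by
  set c := ltqoConst P (Oᴴ * O) with hc
  have h₁ := norm_conj_sub_smul_le_of_mul_eq hP hP₁ hP₁2 hP₁P h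
  have h₂ := norm_conj_sub_smul_le_of_mul_eq hP hP₂ hP₂2 hP₂P h
  have e₁ := abs_norm_sub_norm_le (P₁ * (Oᴴ * O) * P₁) (c • P₁)
  have e₂ := abs_norm_sub_norm_le (P₂ * (Oᴴ * O) * P₂) (c • P₂)
  rw [norm_smul_projection hP₁ hP₁2 h₁0] at e₁
  rw [norm_smul_projection hP₂ hP₂2 h₂0] at e₂
  rw [norm_mul_projection_sq hP₁, norm_mul_projection_sq hP₂]
  have f₁ := (abs_le.mp (e₁.trans h₁))
  have f₂ := (abs_le.mp (e₂.trans h₂))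
  rw [abs_le]
  constructor <;> linarith [f₁.1, f₁.2, f₂.1, f₂.2]

/-- `|a − b| ≤ √|a² − b²|` for `a, b ≥ 0`. [folklore] -/
theorem abs_sub_le_sqrt_abs_sq_sub {a b : ℝ} (ha : 0 ≤ a) (hb : 0 ≤ b) :
    |a - b| ≤ Real.sqrt |a ^ 2 - b ^ 2| := by
  apply Real.abs_le_sqrt
  have h1 : |a - b| ≤ |a + b| := by
    rw [abs_of_nonneg (by linarith : 0 ≤ a + b), abs_le]
    constructor <;> linarith
  calc (a - b) ^ 2 = |a - b| * |a - b| := by rw [← sq_abs, sq]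
    _ ≤ |a - b| * |a + b| := mul_le_mul_of_nonneg_left h1 (abs_nonneg _)
    _ = |a ^ 2 - b ^ 2| := by rw [← abs_mul]; congr 1; ring

/-- **MZ13 Corollary 2.** Under the hypotheses of `abs_norm_mul_sq_sub_le`,
`|‖O P₁‖ − ‖O P₂‖| ≤ √(2η)`. With `P = P_{b_u(r+ℓ)}`, `P₁ = P_{b_u(r+ℓ)}` (or any larger
ball) and `P₂ = P₀`, `η = ‖O‖² Δ₀(ℓ)`, this is eq. (8) of MZ13 (arXiv:1109.1588 p. 8):
"`|‖O_A P_{A(ℓ)}‖ − ‖O_A P₀‖| ≤ 2‖O_A‖ √Δ₀(ℓ)`" (with `√2` in place of `2`).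
[cite: MichalakisZwolakCMP2013, §4 Corollary 2 (arXiv:1109.1588 p. 8, App. A)] -/
theorem abs_norm_mul_sub_norm_mul_le {P P₁ P₂ O : Matrix n n ℂ} (hP : P.IsHermitian)
    (hP₁ : P₁.IsHermitian) (hP₁2 : P₁ * P₁ = P₁) (hP₁P : P₁ * P = P₁) (h₁0 : P₁ ≠ 0)
    (hP₂ : P₂.IsHermitian) (hP₂2 : P₂ * P₂ = P₂) (hP₂P : P₂ * P = P₂) (h₂0 : P₂ ≠ 0)
    {η : ℝ} (h : ‖P * (Oᴴ * O) * P - ltqoConst P (Oᴴ * O) • P‖ ≤ η) :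
    |‖O * P₁‖ - ‖O * P₂‖| ≤ Real.sqrt (2 * η) :=
  (abs_sub_le_sqrt_abs_sq_sub (norm_nonneg _) (norm_nonneg _)).trans
    (Real.sqrt_le_sqrt (abs_norm_mul_sq_sub_le hP hP₁ hP₁2 hP₁P h₁0 hP₂ hP₂2 hP₂P h₂0 h))

end Nested

/-! ### Torus specialisations under `HasLTQO` -/

section Torus

variable {d L : ℕ} [NeZero L] {κ : Type*} [Fintype κ] [DecidableEq κ] {q : ℕ}

/-- **Local-TQO with the intrinsic constant of a larger region** (MZ13 Lemma 3 ingredient). If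
`Φ` has LTQO with rate `Δ`, `O` is a Hermitian observable supported in `cellBall x r`,
`2(r + ℓ) < L`, and `B' ⊇ cellBall x (r + ℓ)` has a non-trivial local ground space (e.g.
`B' = univ`, `P_{B'} = P₀`), then `‖P_{B'} O P_{B'} − c_{P_{B'}}(O) P_{B'}‖ ≤ 2‖O‖ Δ ℓ`.
[cite: MichalakisZwolakCMP2013, §4 Definition 4 and §5 Lemma 3 (arXiv:1109.1588 pp. 7, 12)] -/
theorem HasLTQO.norm_conj_sub_smul_self_le {Φ : Interaction (TorusSite d L × κ) q} {Δ : ℕ → ℝ}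
    (h : HasLTQO Φ Δ) {x : TorusSite d L} {r ℓ : ℕ} {O : Op (TorusSite d L × κ) q}
    (hO : IsSupportedOn O (cellBall x r)) (hOh : O.IsHermitian) (hL : 2 * (r + ℓ) < L)
    {B' : Finset (TorusSite d L × κ)} (hB' : cellBall x (r + ℓ) ⊆ B')
    (h0 : localGroundProj Φ B' ≠ 0) :
    ‖localGroundProj Φ B' * O * localGroundProj Φ B' -
        ltqoConst (localGroundProj Φ B') O • localGroundProj Φ B'‖ ≤ 2 * (‖O‖ * Δ ℓ) :=
  norm_conj_sub_smul_self_le_of_mul_eq (localGroundProj_isHermitian Φ _)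
    (localGroundProj_isHermitian Φ B') (localGroundProj_idempotent Φ B').eq
    (localGroundProj_mul_of_subset_holds Φ hB') h0 hOh (h x r ℓ O hO hL)

/-- The C⋆-identity for the L²-operator norm: `‖Oᴴ O‖ = ‖O‖²`. [folklore] -/
theorem norm_conjTranspose_mul_self_eq_sq {n : Type*} [Fintype n] [DecidableEq n]
    (O : Matrix n n ℂ) : ‖Oᴴ * O‖ = ‖O‖ ^ 2 := by
  rw [l2_opNorm_conjTranspose_mul_self, sq]

/-- **MZ13 Corollary 2 on the torus.** If `Φ` has LTQO with rate `Δ`, `O` is supported in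
`cellBall x r`, `2(r + ℓ) < L`, and `B₁, B₂ ⊇ cellBall x (r + ℓ)` both have non-trivial local
ground spaces, then `|‖O P_{B₁}‖ − ‖O P_{B₂}‖| ≤ √(2 ‖O‖² Δ ℓ)` (LTQO applied to `OᴴO`, which is
supported in the same ball). MZ13 eq. (8) (arXiv:1109.1588 p. 8) is the case
`B₁ = cellBall x (r + ℓ)`, `B₂ = univ`. [cite: MichalakisZwolakCMP2013, §4 Corollary 2 (arXiv:1109.1588 p. 8)] -/
theorem HasLTQO.abs_norm_mul_localGroundProj_sub_le {Φ : Interaction (TorusSite d L × κ) q}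
    {Δ : ℕ → ℝ} (h : HasLTQO Φ Δ) {x : TorusSite d L} {r ℓ : ℕ} {O : Op (TorusSite d L × κ) q}
    (hO : IsSupportedOn O (cellBall x r)) (hL : 2 * (r + ℓ) < L)
    {B₁ B₂ : Finset (TorusSite d L × κ)} (hB₁ : cellBall x (r + ℓ) ⊆ B₁)
    (hB₂ : cellBall x (r + ℓ) ⊆ B₂) (h₁0 : localGroundProj Φ B₁ ≠ 0)
    (h₂0 : localGroundProj Φ B₂ ≠ 0) :
    |‖O * localGroundProj Φ B₁‖ - ‖O * localGroundProj Φ B₂‖| ≤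
      Real.sqrt (2 * (‖O‖ ^ 2 * Δ ℓ)) := by
  have hOO : IsSupportedOn (Oᴴ * O) (cellBall x r) :=
    IsSupportedOn.mul_holds (by simpa [star_eq_conjTranspose] using hO.star) hO
  have h1 := h x r ℓ (Oᴴ * O) hOO hL
  rw [norm_conjTranspose_mul_self_eq_sq] at h1
  exact abs_norm_mul_sub_norm_mul_le (localGroundProj_isHermitian Φ _)
    (localGroundProj_isHermitian Φ B₁) (localGroundProj_idempotent Φ B₁).eq
    (localGroundProj_mul_of_subset_holds Φ hB₁) h₁0
    (localGroundProj_isHermitian Φ B₂) (localGroundProj_idempotent Φ B₂).eq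
    (localGroundProj_mul_of_subset_holds Φ hB₂) h₂0 h1

end Torus

end Literature.MathematicalPhysics.QuantumLattice
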